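import Summits.AnomalousDissipation.AnomalousDissipation.Theorems.UniformResolution.Negative.ResolutionCriterion
import Summits.AnomalousDissipation.AnomalousDissipation.Theorems.CubicParityLoud.Negative.Clauses

/-!
# `MomentParity.ResolvedDissipation` (stmt-AnomalousDissipation-14284), line `enstrophy-ui-transfer`:
# the U3 interface — ANY uniform superlinear enstrophy moment bound gives uniform integrability

Supports stmt-AnomalousDissipation-14284 (helper of the line lead; nothing here closes an item).

The hard stub of the line (uniform integrability of `‖∇u‖²` over the admissible family, crux-equivalent by
`…Reduction` + `…Converse`) sits exactly ONE ORLICZ FACTOR above the known `N`-uniform energy-class budget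
`∫‖∇u‖² dμ ≤ ‖f‖₂R/ν`. This file records the easy direction of de la Vallée-Poussin in the tree's currency: for any
family of laws on `H`, a uniform bound `∫ Φ(‖∇u‖²) dμ ≤ B < ∞` with `Φ` superlinear (`Φ(z) ≥ C z` beyond some finite
level, for every finite `C`) forces `UniformlyIntegrableEnstrophy` — so every `N`-uniform a-priori estimate of the form
`sup_{N, μ admissible} E_μ[Φ(‖∇u‖²)] < ∞` (`Φ(z) = z log(2+z)`, `z^{1+δ}`, …) closes the crux at that `(f, ν, R)`.
No such estimate is known for 3-D Galerkin-invariant laws (FMRT 2001 IV gives `E‖∇u‖²` and `E|Au|^{2/3}` only).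

* `uniformlyIntegrableEnstrophy_of_superlinear` — the de la Vallée-Poussin direction, in `ℝ≥0∞`.
-/

noncomputable section

-- `Summit.<Summit>.<Problem>`: single-conjunct summit, the duplicate namespace segment is mandated.
set_option linter.dupNamespace false

namespace Summit.AnomalousDissipation.AnomalousDissipation.Theorems.MomentParityResolvedDissipation

open MeasureTheory Filter Topology
open scoped ENNReal InnerProductSpace RealInnerProductSpace
open Literature.Analysis.FunctionSpaces Literature.Analysis.FluidPDE
open Summit.AnomalousDissipation.AnomalousDissipation.Theses.MomentParity
open Summit.AnomalousDissipation.AnomalousDissipation.Theorems.CubicParityLoud.Negative (T3 R3 H3 L2T3)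
open Summit.AnomalousDissipation.AnomalousDissipation.Theorems.UniformResolution.Negative
  (UniformlyIntegrableEnstrophy)

/-- **de la Vallée-Poussin, easy direction (the U3 interface of the hard stub).** Let `𝓕` be a family of laws on
`H` and `Φ : ℝ≥0∞ → ℝ≥0∞` a measurable SUPERLINEAR weight — for every finite `C` there is a finite level `M` with
`C z ≤ Φ z` for all `z > M` — with a uniform bound `∫ Φ(‖∇u‖²) dμ ≤ B < ∞` over `𝓕`. Then the enstrophy is uniformly
integrable over `𝓕`: given `η > 0` put `C = B η⁻¹ + 1`; beyond the level `M(C)`,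
`C ∫_{‖∇u‖²>M} ‖∇u‖² ≤ ∫ Φ(‖∇u‖²) ≤ B ≤ C η`. [folklore] -/
theorem uniformlyIntegrableEnstrophy_of_superlinear :
    ∀ (𝓕 : Set (Measure H3)) (Φ : ℝ≥0∞ → ℝ≥0∞) (B : ℝ≥0∞), Measurable Φ → B ≠ ⊤ →
    (∀ C : ℝ≥0∞, C ≠ ⊤ → ∃ M : ℝ≥0∞, M ≠ ⊤ ∧ ∀ z : ℝ≥0∞, M < z → C * z ≤ Φ z) →
    (∀ μ ∈ 𝓕, ∫⁻ u, Φ (Torus.eGradNormSq (u.1 : T3 → R3)) ∂μ ≤ B) →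
    UniformlyIntegrableEnstrophy 𝓕 := by
  intro 𝓕 Φ B hΦ hB hsuper hbound η hη
  -- the constant `C = B η⁻¹ + 1`: finite, nonzero, with `B ≤ C η`
  set C : ℝ≥0∞ := B * η⁻¹ + 1 with hC
  have hη0 : η ≠ 0 := hη.ne'
  have hCtop : C ≠ ⊤ := by
    rw [hC]
    exact ENNReal.add_ne_top.2 ⟨ENNReal.mul_ne_top hB (ENNReal.inv_ne_top.2 hη0), ENNReal.one_ne_top⟩
  have hC0 : C ≠ 0 := by
    rw [hC]
    exact ne_of_gt (lt_of_lt_of_le zero_lt_one le_add_self)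
  have hBC : B ≤ C * η := by
    rw [hC, add_mul, one_mul]
    by_cases hηtop : η = ⊤
    · rw [hηtop]
      exact le_top.trans_eq (by simp)
    · rw [mul_assoc, ENNReal.inv_mul_cancel hη0 hηtop, mul_one]
      exact le_self_add
  obtain ⟨M, hM, hMΦ⟩ := hsuper C hCtop
  refine ⟨M, hM, fun μ hμ => ?_⟩
  -- abbreviation and measurability
  set Z : H3 → ℝ≥0∞ := fun u => Torus.eGradNormSq (u.1 : T3 → R3) with hZ
  have hZm : Measurable Z := Torus.measurable_eGradNormSq_coe
  have hS : MeasurableSet {u : H3 | M < Z u} := measurableSet_lt measurable_const hZm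
  -- `C · ∫_{Z>M} Z ≤ ∫ Φ(Z) ≤ B ≤ C η`
  have key : C * ∫⁻ u in {u : H3 | M < Z u}, Z u ∂μ ≤ C * η := by
    calc C * ∫⁻ u in {u : H3 | M < Z u}, Z u ∂μ
        = ∫⁻ u in {u : H3 | M < Z u}, C * Z u ∂μ := (lintegral_const_mul C hZm).symm
      _ ≤ ∫⁻ u in {u : H3 | M < Z u}, Φ (Z u) ∂μ :=
          setLIntegral_mono (hΦ.comp hZm) fun u hu => hMΦ (Z u) hu
      _ ≤ ∫⁻ u, Φ (Z u) ∂μ := setLIntegral_le_lintegral _ _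
      _ ≤ B := hbound μ hμ
      _ ≤ C * η := hBC
  exact (ENNReal.mul_le_mul_iff_right hC0 hCtop).1 key

end Summit.AnomalousDissipation.AnomalousDissipation.Theorems.MomentParityResolvedDissipation

end
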